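/-
Copyright (c) 2026. All rights reserved.
Released under Apache 2.0 license as described in the file LICENSE.
Authors: abc-iut cell, seat abc-iut-L4-t15 (gen 6).
-/
import Mathlib.Topology.Algebra.Group.Basic
import Mathlib.Topology.Constructions
import Mathlib.GroupTheory.Commutator.Basic
import Mathlib.Algebra.Group.Subgroup.ZPowers.Basic

/-!
# Transport of closures of `⟨τ⟩P` to an open (or any) subgroup

For a subgroup `U ≤ G` of a topological group, `P ≤ U` and `τ ∈ U`, the closure of `⟨τ⟩ P_U` inside `↥U`
(`P_U = P.subgroupOf U`) is the trace of the closure of `⟨τ⟩ P` in `G`: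

* `map_subtype_zpowers_sup_subgroupOf` — `(⟨τ⟩ ⊔ P_U).map U.subtype = ⟨τ⟩ ⊔ P`;
* `mem_closure_zpowers_sup_subgroupOf_iff` — `x ∈ cl_U(⟨τ⟩ P_U) ↔ ↑x ∈ cl_G(⟨τ⟩ P)`;
* `conj_mem_closure_subgroupOf`, `conj_mul_inv_mem_closure_subgroupOf` — the conjugation hypotheses
  `(S2)` of the `p`-by-metacyclic setting pass from `G` (restricted to `U`) to `↥U`;
* `dense_coe_iff_subset_closure_map` — `S ≤ ↥U` is dense iff `U ⊆ cl_G(S.map U.subtype)`.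

Mathlib-only; no definitions, no instances (cell abc-iut, GAP-LEDGER G-L3d2g2-1: inheritance step of the
strong-completeness reduction for `p`-by-metacyclic profinite groups). [cite: RibesZalesskii2010, §2.1]
-/

namespace Literature.GroupTheory

open scoped commutatorElement

variable {G : Type*} [Group G]

/-- `(⟨τ⟩ ⊔ P.subgroupOf U).map U.subtype = ⟨τ⟩ ⊔ P` for `P ≤ U`, `τ ∈ U`. [cite: RibesZalesskii2010, §2.1] -/
theorem map_subtype_zpowers_sup_subgroupOf (U P : Subgroup G) (hPU : P ≤ U) (τ : G) (hτ : τ ∈ U) :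
    (Subgroup.zpowers (⟨τ, hτ⟩ : U) ⊔ P.subgroupOf U).map U.subtype = Subgroup.zpowers τ ⊔ P := by
  rw [Subgroup.map_sup, MonoidHom.map_zpowers, Subgroup.subgroupOf_map_subtype, inf_eq_left.mpr hPU]
  rfl

variable [TopologicalSpace G]

/-- **Closures inside a subgroup.**  For `P ≤ U`, `τ ∈ U` and `x ∈ U`:
`x ∈ cl_U(⟨τ⟩ P_U) ↔ ↑x ∈ cl_G(⟨τ⟩ P)`. [cite: RibesZalesskii2010, §2.1] -/
theorem mem_closure_zpowers_sup_subgroupOf_iff (U P : Subgroup G) (hPU : P ≤ U) (τ : G) (hτ : τ ∈ U)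
    (x : U) :
    x ∈ closure ((Subgroup.zpowers (⟨τ, hτ⟩ : U) ⊔ P.subgroupOf U : Subgroup U) : Set U) ↔
      (x : G) ∈ closure ((Subgroup.zpowers τ ⊔ P : Subgroup G) : Set G) := by
  rw [Topology.IsInducing.subtypeVal.closure_eq_preimage_closure_image, Set.mem_preimage,
    ← Subgroup.coe_subtype, ← Subgroup.coe_map, map_subtype_zpowers_sup_subgroupOf U P hPU τ hτ]
  rfl

/-- **`(S2)(a)` passes to `↥U`.**  If `u τ u⁻¹ ∈ cl(⟨τ⟩P)` for all `u ∈ U`, then in `↥U` all conjugates of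
`τ` lie in `cl_U(⟨τ⟩ P_U)`. [cite: RibesZalesskii2010, §2.1] -/
theorem conj_mem_closure_subgroupOf (U P : Subgroup G) (hPU : P ≤ U) (τ : G) (hτ : τ ∈ U)
    (hconj : ∀ u ∈ U, u * τ * u⁻¹ ∈ closure ((Subgroup.zpowers τ ⊔ P : Subgroup G) : Set G)) :
    ∀ w : U, w * ⟨τ, hτ⟩ * w⁻¹ ∈
      closure ((Subgroup.zpowers (⟨τ, hτ⟩ : U) ⊔ P.subgroupOf U : Subgroup U) : Set U) := by
  intro w
  rw [mem_closure_zpowers_sup_subgroupOf_iff U P hPU τ hτ]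
  simpa using hconj w w.2

/-- **`(S2)(b)` passes to `↥U`.**  If `⁅u, v⁆ ∈ cl(⟨τ⟩P)` for all `u, v ∈ U`, then in `↥U`, for every
`σ ∈ U`, all `w σ w⁻¹ σ⁻¹` lie in `cl_U(⟨τ⟩ P_U)`. [cite: RibesZalesskii2010, §2.1] -/
theorem conj_mul_inv_mem_closure_subgroupOf (U P : Subgroup G) (hPU : P ≤ U) (τ : G) (hτ : τ ∈ U)
    (hcomm : ∀ u ∈ U, ∀ v ∈ U, ⁅u, v⁆ ∈ closure ((Subgroup.zpowers τ ⊔ P : Subgroup G) : Set G))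
    (σ : U) :
    ∀ w : U, w * σ * w⁻¹ * σ⁻¹ ∈
      closure ((Subgroup.zpowers (⟨τ, hτ⟩ : U) ⊔ P.subgroupOf U : Subgroup U) : Set U) := by
  intro w
  rw [mem_closure_zpowers_sup_subgroupOf_iff U P hPU τ hτ]
  have h := hcomm w w.2 σ σ.2
  rw [commutatorElement_def] at h
  simpa using h

/-- **Density inside a subgroup.**  A subgroup `S ≤ ↥U` is dense in `↥U` iff `U ⊆ cl_G(S.map U.subtype)`.
[cite: RibesZalesskii2010, §2.1] -/
theorem dense_coe_iff_subset_closure_map (U : Subgroup G) (S : Subgroup U) :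
    Dense ((S : Subgroup U) : Set U) ↔ (U : Set G) ⊆ closure ((S.map U.subtype : Subgroup G) : Set G) := by
  have hc : closure ((S : Subgroup U) : Set U) =
      Subtype.val ⁻¹' closure ((S.map U.subtype : Subgroup G) : Set G) := by
    rw [Topology.IsInducing.subtypeVal.closure_eq_preimage_closure_image, Subgroup.coe_map,
      Subgroup.coe_subtype]
    rfl
  rw [dense_iff_closure_eq, hc]
  constructor
  · intro h x hx
    have : (⟨x, hx⟩ : U) ∈ Subtype.val ⁻¹' closure ((S.map U.subtype : Subgroup G) : Set G) := by
      rw [h]; exact Set.mem_univ _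
    exact this
  · intro h
    exact Set.eq_univ_of_forall fun x => h x.2

end Literature.GroupTheory
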